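import Mathlib.FieldTheory.Galois.Infinite
import Literature.NumberTheory.AdelicBaseChange.CompletionBaseChange
import Literature.NumberTheory.GaloisRepresentations.AbsGaloisGroupProofs
import Literature.NumberTheory.GaloisRepresentations.LocalWeilDatum
import Literature.NumberTheory.GaloisRepresentations.PadicAlgebraOfLocalField
import HarnessLib

/-!
# Crux `PrintCf2.SplitBadTwoRankOneOfFacts` (stmt-BirchSwinnertonDyer-20368), S3n′-FACT-FREE road, brick R2/B4c = (P):
# LOCAL `n`-TH POWERS AT THE PLACES `w ∣ v` — GALOIS SIDE (`K̄_v`, `θ_v⁻¹(σ·Gal(K̄/F)·σ⁻¹)`) ⟷ COMPLETION SIDE (`F_w`)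

Cell `bsd-print-cf2`, WIDTH seat `bsd-line-cf2-p1-w6` g6 (prover-bsd-line-cf2-p1-w6-g6-0); `--supports stmt-BirchSwinnertonDyer-20368` (helper,
Theses-free). HONEST FRAMING: field theory and number-field plumbing; nothing here closes the crux or a registered stub; BSD is not proved by
any of this; no summit statement is proved by this seat. No definition, no named fact, no instance, no `sorry`.

ROLE ON THE ROAD (memos `Cruxes/SplitBadTwoRankOneOfFacts/S3N-FACTFREE-w2g14.md` §2–§3, `R2-BRICKS-w5g7.md` §3, brick B4c = (P),
«NOT stated anywhere»): the (PRO-NULL) input R1 (`KummerProNull.exists_level_forall_exists_pow_eq_of_local`, -w2 g14, binder (ii))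
asks, at every place `w ∣ v` of the layer field `F`, for «`x` is a `p^M`-th power in `F_w = w.1.adicCompletion F`»; what the dual
Selmer condition STRICT at `v` delivers (Poitou–Tate over `K` + Shapiro/Mackey, -w5 g7 B2; or Γ_F-currency, -w7 g6) is, for every
`σ ∈ Γ_K`, «the Kummer cocycle of `σ•x` is a coboundary on the local group `θ_v⁻¹(σ·Gal(K̄/F)·σ⁻¹) = Gal(K̄_v / K_v·ι_v(σF))`».
This file is the dictionary between the two, for the tree's CHOSEN embedding `ι_v = absClosureEmbedding K K_v : K̄ →ₐ[K] K̄_v` and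
restriction `θ_v = absGaloisRestrict K K_v : Γ_{K_v} → Γ_K` (`ι_v (θ_v τ • y) = τ • ι_v y`), `K_v = v.adicCompletion K`,
`K̄_v = AlgebraicClosure K_v`, `F : IntermediateField K K̄` finite over `K`, `Gal(K̄/F) = galFixing K F`, and `F_w` with the
`K_v`-algebra structure of the tree's FLT packet `AdelicBaseChange/CompletionBaseChange` (`F_w` finite over `K_v`;
`F ⊗[K] K_v ≅ ∏_{w∣v} F_w`, Cassels–Fröhlich II (10.2)).

* §1 `exists_fixed_pow_eq_iff_exists_pow_eq_one` — MODEL-FREE Kummer unpacking: for a monoid acting on a field by ring maps,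
  `H` any subset, `αⁿ = a ≠ 0`: «some `H`-fixed `z` has `zⁿ = a`» ⟺ «`∃ ζ, ζⁿ = 1 ∧ ∀ τ ∈ H, τα·α⁻¹ = τζ·ζ⁻¹`» (the cocycle
  `τ ↦ τα/α` is a `μₙ`-coboundary on `H`) — plugs into the `subgroupH1` / `galoisCohomology` / `ContOneCocycle` dialects alike.
* §2 `exists_pow_eq_iff_exists_forall_fixed_pow_eq` — for `E` of characteristic `0`, `D/E` a field extension, `e : D →ₐ[E] Ē`:
  «`d ∈ Dⁿ`» ⟺ «some `z ∈ Ē` fixed by the pointwise fixer of `e(D)` has `zⁿ = e d`» (Krull, Mathlib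
  `InfiniteGalois.fixedField_fixingSubgroup`); `…_absoluteGaloisGroup` spelling and the combined `…_pow_eq_one_…` form.
* §3 `conj_absGaloisRestrict_mem_galFixing_iff` — for ANY extension `L/K`: «`σ⁻¹·θ_L τ·σ ∈ Gal(K̄/F)` ⟺ `τ` fixes `ι_L(σF)`
  pointwise», i.e. `θ_L⁻¹(σ·Gal(K̄/F)·σ⁻¹) = Gal(L̄ / L·ι_L(σF))` with NO completion of `F` mentioned; `σ = 1` and `MulAut.conj` forms.
* §4 `exists_algHom_adicCompletion_apply_eq_smul` — **every place `w ∣ v` of `F` is cut out by a conjugate `ι_v ∘ σ`**: there are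
  `σ ∈ Γ_K` and `e : F_w →ₐ[K_v] K̄_v` with `e x = ι_v (σ • x)` on `F` (Neukirch II (8.1)–(8.3); `IsAlgClosed.lift` twice +
  `exists_absClosureEmbedding_comp_eq`); `algebraMap_adicCompletion_algebraMap` (the square `K → K_v → F_w = K → F → F_w`).
* §5 `span_range_algebraMap_adicCompletion_eq_top` (`F_w = K_v·F`), `forall_smul_algHom_apply_eq_iff` (fixing `e(F_w)` pointwise
  ⟺ fixing `e(F)` pointwise ⟺ `σ⁻¹·θ_v τ·σ ∈ Gal(K̄/F)`).
* §6 **`exists_pow_eq_adicCompletion_iff_exists_fixed_pow_eq`** «(`∃ y : F_w, yⁿ = x`) ⟺ (`∃ z : K̄_v` fixed by every `τ` with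
  `σ⁻¹·θ_v τ·σ ∈ Gal(K̄/F)`, `zⁿ = ι_v (σ • x)`)», **`exists_pow_eq_adicCompletion_iff_exists_pow_eq_one`** (the coboundary form) and
  the road's consumer shapes **`forall_extension_exists_pow_eq_of_forall_exists_fixed`** / **`…_of_forall_exists_pow_eq_one`**:
  «fixed root / coboundary on `θ_v⁻¹(σ·Gal(K̄/F)·σ⁻¹)` for EVERY `σ`» ⟹ «`x ∈ (F_w)ⁿ` for EVERY `w ∣ v`» = R1's binder (ii) verbatim.

References: Neukirch, *Algebraic Number Theory* (1999) II (8.1)–(8.3), (9.6), IV §1, §3; Serre, *Local Fields* (1979) X §3 b); Cassels–Fröhlich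
(1967) II §10 (10.2); Milne, *Fields and Galois Theory* Ch. 6–7.
presearch: folklore; nearest tree statements `SorensenPatching.exists_absGaloisRestrict_absGaloisRestrict_eq_conj`, `ToLocalRestrictField`
(tower restrictions up to conjugacy; no completion/`n`-th-power dictionary). beyond-print theorem: no.
-/


set_option linter.dupNamespace false

noncomputable section
namespace Summit.BirchSwinnertonDyer.BirchSwinnertonDyer.Theorems.PrintCf2.LocalPowersAtV

/-! ## §1. The model-free Kummer unpacking: fixed `n`-th root ⟺ cocycle `τ ↦ τα/α` is a `μₙ`-coboundary on `H` -/

section KummerUnpack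

variable {G Ω : Type*} [Monoid G] [Field Ω] [MulSemiringAction G Ω]

/-- A ring-map action on a field is injective: `τ • x = 0 ↔ x = 0`. [folklore] -/
theorem smul_eq_zero_iff_eq_zero (τ : G) (x : Ω) : τ • x = 0 ↔ x = 0 :=
  ⟨fun h ↦ (MulSemiringAction.toRingHom G Ω τ).injective (by simpa using h), fun h ↦ by simp [h]⟩

/-- **Fixed `n`-th root ⟺ Kummer coboundary (model-free).** Let a monoid `G` act on a field `Ω` by ring maps, `H ⊆ G` any
subset, `α ∈ Ω` with `αⁿ = a ≠ 0`. Then some `H`-fixed `z ∈ Ω` satisfies `zⁿ = a` iff there is `ζ` with `ζⁿ = 1` and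
`τ • α * α⁻¹ = τ • ζ * ζ⁻¹` for all `τ ∈ H` (the Kummer `1`-cocycle `τ ↦ τα/α ∈ μₙ` is the coboundary of `ζ` on `H`).
(`→`: `ζ := α z⁻¹`; `←`: `z := α ζ⁻¹`.) [cite: SerreLocalFields1979, X §3 b)] -/
theorem exists_fixed_pow_eq_iff_exists_pow_eq_one (H : Set G) {n : ℕ} {a α : Ω} (hα : α ^ n = a) (ha : a ≠ 0) :
    (∃ z : Ω, (∀ τ ∈ H, τ • z = z) ∧ z ^ n = a) ↔
      ∃ ζ : Ω, ζ ^ n = 1 ∧ ∀ τ ∈ H, τ • α * α⁻¹ = τ • ζ * ζ⁻¹ := by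
  rcases Nat.eq_zero_or_pos n with hn | hn
  · -- `n = 0`: both sides hold (`a = 1`; take `z := 1`, `ζ := α`)
    subst hn
    rw [pow_zero] at hα
    exact ⟨fun _ ↦ ⟨α, by rw [pow_zero], fun τ _ ↦ rfl⟩, fun _ ↦ ⟨1, fun τ _ ↦ smul_one τ, by rw [pow_zero, hα]⟩⟩
  have hα0 : α ≠ 0 := by
    rintro rfl
    exact ha (by rw [← hα, zero_pow hn.ne'])
  constructor
  · rintro ⟨z, hz, hzn⟩
    have hz0 : z ≠ 0 := by
      rintro rfl
      exact ha (by rw [← hzn, zero_pow hn.ne'])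
    refine ⟨α * z⁻¹, ?_, fun τ hτ ↦ ?_⟩
    · rw [mul_pow, inv_pow, hα, hzn, mul_inv_cancel₀ ha]
    · rw [smul_mul', smul_inv'', hz τ hτ, mul_inv, inv_inv]
      field_simp
  · rintro ⟨ζ, hζn, hζ⟩
    have hζ0 : ζ ≠ 0 := by
      rintro rfl
      rw [zero_pow hn.ne'] at hζn
      exact zero_ne_one hζn
    refine ⟨α * ζ⁻¹, fun τ hτ ↦ ?_, ?_⟩
    · have hτζ : τ • ζ ≠ 0 := fun h ↦ hζ0 ((smul_eq_zero_iff_eq_zero τ ζ).1 h)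
      have hτα : τ • α ≠ 0 := fun h ↦ hα0 ((smul_eq_zero_iff_eq_zero τ α).1 h)
      have key := hζ τ hτ
      rw [smul_mul', smul_inv'']
      have hτα' : τ • α = τ • ζ * ζ⁻¹ * α := by rw [← key, inv_mul_cancel_right₀ hα0]
      rw [hτα']
      field_simp
    · rw [mul_pow, inv_pow, hα, hζn, inv_one, mul_one]

end KummerUnpack

/-! ## §2. `n`-th power in a finite (algebraic) subextension `D ↪ Ē` ⟺ an `n`-th root in `Ē` fixed by `Gal(Ē / e(D))` -/

section FixedField

variable {E : Type*} [Field E] [CharZero E] {D : Type*} [Field D] [Algebra E D]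

/-- **`d ∈ D` is an `n`-th power in `D` iff `e d` has an `n`-th root in `Ē` fixed by every `E`-automorphism of `Ē` fixing
`e(D)` pointwise** (`e : D →ₐ[E] Ē` any `E`-embedding; `Ē/E` is Galois in characteristic `0`, so the fixed field of
`Gal(Ē/e(D))` is `e(D)` — Krull, Mathlib `InfiniteGalois.fixedField_fixingSubgroup`). [cite: NeukirchANT1999, Ch. IV §1 (Krull's theorem (1.2))] -/
theorem exists_pow_eq_iff_exists_forall_fixed_pow_eq (e : D →ₐ[E] AlgebraicClosure E) (d : D) (n : ℕ) :
    (∃ y : D, y ^ n = d) ↔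
      ∃ z : AlgebraicClosure E,
        (∀ τ : AlgebraicClosure E ≃ₐ[E] AlgebraicClosure E, (∀ x : D, τ (e x) = e x) → τ z = z) ∧ z ^ n = e d := by
  constructor
  · rintro ⟨y, rfl⟩
    exact ⟨e y, fun τ hτ ↦ hτ y, by rw [map_pow]⟩
  · rintro ⟨z, hz, hzn⟩
    have hmem : z ∈ IntermediateField.fixedField e.fieldRange.fixingSubgroup := by
      intro τ
      refine hz τ fun x ↦ ?_
      exact (IntermediateField.mem_fixingSubgroup_iff _ _).1 τ.2 (e x) ⟨x, rfl⟩
    rw [InfiniteGalois.fixedField_fixingSubgroup] at hmem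
    obtain ⟨y, hy⟩ := hmem
    refine ⟨y, e.toRingHom.injective ?_⟩
    change e (y ^ n) = e d
    rw [map_pow]
    exact hy ▸ hzn

/-- The same with the automorphisms spelled as elements of the tree's `absoluteGaloisGroup E` acting on `Ē`
(`Field.absoluteGaloisGroup.smul_def`: `τ • z = toAlgEquiv τ z`). [cite: NeukirchANT1999, Ch. IV §1 (Krull's theorem (1.2))] -/
theorem exists_pow_eq_iff_exists_forall_fixed_pow_eq_absoluteGaloisGroup (e : D →ₐ[E] AlgebraicClosure E) (d : D)
    (n : ℕ) :
    (∃ y : D, y ^ n = d) ↔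
      ∃ z : AlgebraicClosure E,
        (∀ τ : Field.absoluteGaloisGroup E, (∀ x : D, τ • e x = e x) → τ • z = z) ∧ z ^ n = e d := by
  rw [exists_pow_eq_iff_exists_forall_fixed_pow_eq e d n]
  rfl

/-- **Combined form (the shape the (PRO-NULL) road consumes).** For `e : D →ₐ[E] Ē`, `d ∈ D`, `α ∈ Ē` with `αⁿ = e d ≠ 0`:
`d` is an `n`-th power in `D` iff the Kummer cocycle `τ ↦ τα/α` is a `μₙ`-coboundary on the subgroup of `absoluteGaloisGroup E`
fixing `e(D)` pointwise. [cite: SerreLocalFields1979, X §3 b)] -/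
theorem exists_pow_eq_iff_exists_pow_eq_one_absoluteGaloisGroup (e : D →ₐ[E] AlgebraicClosure E) {d : D} {n : ℕ}
    {α : AlgebraicClosure E} (hα : α ^ n = e d) (hd : d ≠ 0) :
    (∃ y : D, y ^ n = d) ↔
      ∃ ζ : AlgebraicClosure E, ζ ^ n = 1 ∧
        ∀ τ : Field.absoluteGaloisGroup E, (∀ x : D, τ • e x = e x) → τ • α * α⁻¹ = τ • ζ * ζ⁻¹ := by
  rw [exists_pow_eq_iff_exists_forall_fixed_pow_eq_absoluteGaloisGroup e d n]
  have h := exists_fixed_pow_eq_iff_exists_pow_eq_one (G := Field.absoluteGaloisGroup E)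
    {τ : Field.absoluteGaloisGroup E | ∀ x : D, τ • e x = e x} hα ((map_ne_zero e.toRingHom).2 hd)
  simpa only [Set.mem_setOf_eq] using h

end FixedField

/-! ## §3. `θ_L⁻¹(σ·Gal(K̄/F)·σ⁻¹)` is the pointwise fixer of `ι_L(σF)` in `Γ_L` -/

section ConjFixing

open scoped Pointwise
open Literature.NumberTheory.GaloisRepresentations Literature.NumberTheory.GaloisRepresentations.LocalWeilDatum

variable (K L : Type*) [Field K] [Field L] [Algebra K L]

/-- **`σ⁻¹ · θ_L τ · σ ∈ Gal(K̄/F)` iff `τ` fixes `ι_L(σ x)` for every `x ∈ F`.** Here `ι_L = absClosureEmbedding K L : K̄ →ₐ[K] L̄`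
is the tree's chosen embedding along the extension `L/K` and `θ_L = absGaloisRestrict K L : Γ_L → Γ_K` the restriction it induces
(`ι_L (θ_L τ • y) = τ • ι_L y`). So `θ_L⁻¹(σ·Gal(K̄/F)·σ⁻¹)` is the subgroup of `Γ_L` fixing `ι_L(σF)` pointwise — for `L = K_v` a
completion, the absolute Galois group of the compositum `K_v·ι_v(σF) ⊆ K̄_v`, i.e. the local group at the place of `F` cut out by
`ι_v ∘ σ`. [cite: NeukirchANT1999, Ch. II §9 Prop. (9.6)] -/
theorem conj_absGaloisRestrict_mem_galFixing_iff (F : IntermediateField K (AlgebraicClosure K))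
    (σ : Field.absoluteGaloisGroup K) (τ : Field.absoluteGaloisGroup L) :
    σ⁻¹ * absGaloisRestrict K L τ * σ ∈ galFixing K F ↔
      ∀ x : AlgebraicClosure K, x ∈ F →
        τ • absClosureEmbedding K L (σ • x) = absClosureEmbedding K L (σ • x) := by
  rw [mem_galFixing_iff]
  refine forall₂_congr fun x _ ↦ ?_
  rw [mul_smul, mul_smul, inv_smul_eq_iff, ← absGaloisRestrict_apply_smul]
  exact ⟨fun h ↦ congrArg _ h, fun h ↦ (absClosureEmbedding K L).toRingHom.injective h⟩

/-- The case `σ = 1`: **`θ_L τ ∈ Gal(K̄/F)` iff `τ` fixes `ι_L(F)` pointwise** (`θ_L⁻¹(Gal(K̄/F)) = Gal(L̄ / L·ι_L F)`).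
[cite: NeukirchANT1999, Ch. II §9 Prop. (9.6)] -/
theorem absGaloisRestrict_mem_galFixing_iff (F : IntermediateField K (AlgebraicClosure K)) (τ : Field.absoluteGaloisGroup L) :
    absGaloisRestrict K L τ ∈ galFixing K F ↔
      ∀ x : AlgebraicClosure K, x ∈ F → τ • absClosureEmbedding K L x = absClosureEmbedding K L x := by
  simpa only [inv_one, one_mul, mul_one, one_smul] using conj_absGaloisRestrict_mem_galFixing_iff K L F 1 τ

/-- Reformulation with the conjugate subgroup: **`θ_L τ ∈ σ · Gal(K̄/F) · σ⁻¹`** (Mathlib `MulAut.conj σ • U`) iff `τ` fixes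
`ι_L(σF)` pointwise. [cite: NeukirchANT1999, Ch. II §9 Prop. (9.6)] -/
theorem absGaloisRestrict_mem_conj_smul_galFixing_iff (F : IntermediateField K (AlgebraicClosure K))
    (σ : Field.absoluteGaloisGroup K) (τ : Field.absoluteGaloisGroup L) :
    absGaloisRestrict K L τ ∈ MulAut.conj σ • galFixing K F ↔
      ∀ x : AlgebraicClosure K, x ∈ F →
        τ • absClosureEmbedding K L (σ • x) = absClosureEmbedding K L (σ • x) := by
  rw [← conj_absGaloisRestrict_mem_galFixing_iff K L F σ τ, Subgroup.mem_pointwise_smul_iff_inv_smul_mem, ← map_inv,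
    MulAut.smul_def, MulAut.conj_apply, inv_inv]

end ConjFixing

/-! ## §4. Places `w ∣ v` of `F`: the square `K → K_v → F_w = K → F → F_w`, and `F_w ↪ K̄_v` over `K_v` extending `ι_v ∘ σ` -/

section AtV

open scoped NumberField
open IsDedekindDomain Field
open Literature.NumberTheory.GaloisRepresentations Literature.NumberTheory.GaloisRepresentations.LocalWeilDatum

variable {K : Type} [Field K] [NumberField K] (v : HeightOneSpectrum (𝓞 K))
  (F : IntermediateField K (AlgebraicClosure K)) [NumberField F]

/-- **`algebraMap K_v F_w (algebraMap K K_v k) = algebraMap F F_w (algebraMap K F k)`** (FLT packet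
`Extension.adicCompletionSemialgHom_coe`). [cite: CasselsFrohlichANT1967, Ch. II §10 (canonical map k_v → K_w)] -/
theorem algebraMap_adicCompletion_algebraMap (w : v.Extension (𝓞 F)) (k : K) :
    algebraMap (v.adicCompletion K) (w.1.adicCompletion F) (algebraMap K (v.adicCompletion K) k) =
      algebraMap F (w.1.adicCompletion F) (algebraMap K F k) :=
  HeightOneSpectrum.Extension.adicCompletionSemialgHom_coe K F w (WithVal.toVal _ k)

/-- `F_w` is algebraic over `K_v` (it is finite over `K_v`, FLT packet). [cite: CasselsFrohlichANT1967, Ch. II §10 Theorem (10.2)] -/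
theorem isAlgebraic_adicCompletion (w : v.Extension (𝓞 F)) :
    Algebra.IsAlgebraic (v.adicCompletion K) (w.1.adicCompletion F) :=
  Algebra.IsAlgebraic.of_finite _ _

/-- **Every place `w ∣ v` of `F` is cut out by a conjugate `ι_v ∘ σ` of the chosen embedding**: there are `σ ∈ Γ_K` and a
`K_v`-algebra embedding `e : F_w →ₐ[K_v] K̄_v` with `e x = ι_v (σ • x)` for every `x ∈ F`.
[cite: NeukirchANT1999, Ch. II §8 (8.1)–(8.3)] -/
theorem exists_algHom_adicCompletion_apply_eq_smul (w : v.Extension (𝓞 F)) :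
    ∃ (σ : absoluteGaloisGroup K)
      (e : w.1.adicCompletion F →ₐ[v.adicCompletion K] AlgebraicClosure (v.adicCompletion K)),
      ∀ x : F, e (algebraMap F (w.1.adicCompletion F) x) =
        absClosureEmbedding K (v.adicCompletion K) (σ • (x : AlgebraicClosure K)) := by
  haveI := isAlgebraic_adicCompletion v F w
  set Kv := v.adicCompletion K
  set Fw := w.1.adicCompletion F
  let e : Fw →ₐ[Kv] AlgebraicClosure Kv := IsAlgClosed.lift
  let φ : F →ₐ[K] AlgebraicClosure Kv :=
    { toRingHom := e.toRingHom.comp (algebraMap F Fw)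
      commutes' := fun k ↦ by
        change e (algebraMap F Fw (algebraMap K F k)) = algebraMap K (AlgebraicClosure Kv) k
        rw [← algebraMap_adicCompletion_algebraMap v F w k, AlgHom.commutes,
          ← IsScalarTower.algebraMap_apply] }
  letI : Algebra F (AlgebraicClosure Kv) := φ.toRingHom.toAlgebra
  haveI : IsScalarTower K F (AlgebraicClosure Kv) :=
    IsScalarTower.of_algebraMap_eq fun k ↦ (φ.commutes k).symm
  haveI : FaithfulSMul F (AlgebraicClosure Kv) :=
    (faithfulSMul_iff_algebraMap_injective F (AlgebraicClosure Kv)).2 φ.toRingHom.injective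
  haveI : Module.IsTorsionFree F (AlgebraicClosure Kv) := FaithfulSMul.to_isTorsionFree F _
  haveI : Algebra.IsAlgebraic F (AlgebraicClosure K) := Algebra.IsAlgebraic.tower_top (K := K) F
  let Φ : AlgebraicClosure K →ₐ[F] AlgebraicClosure Kv := IsAlgClosed.lift
  obtain ⟨σ, hσ⟩ := exists_absClosureEmbedding_comp_eq K Kv (Φ.restrictScalars K)
  refine ⟨σ, e, fun x ↦ ?_⟩
  rw [hσ]
  change φ x = Φ (algebraMap F (AlgebraicClosure K) x)
  rw [AlgHom.commutes]
  rfl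

/-! ## §5. `F_w` is spanned over `K_v` by the image of `F`; fixing `e(F)` pointwise = fixing `e(F_w)` pointwise -/

open scoped TensorProduct in
/-- **Every element of `F_w` is a finite sum `Σ fᵢ cᵢ`, `fᵢ ∈ F`, `cᵢ ∈ K_v`**: the image of `F` generates `F_w` as a `K_v`-module
(projection to the factor `w` of the packet's bijection `F ⊗[K] K_v ≅ ∏_{w∣v} F_w`, Cassels–Fröhlich II (10.2)).
[cite: CasselsFrohlichANT1967, Ch. II §10 Theorem (10.2)] -/
theorem span_range_algebraMap_adicCompletion_eq_top [FiniteDimensional K F] (w : v.Extension (𝓞 F)) :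
    Submodule.span (v.adicCompletion K) (Set.range (algebraMap F (w.1.adicCompletion F))) = ⊤ := by
  classical
  rw [eq_top_iff]
  rintro y -
  obtain ⟨t, ht⟩ := (HeightOneSpectrum.adicCompletion.baseChange_bijective K F (𝓞 F) v).2 (Pi.single w y)
  have hy : y = HeightOneSpectrum.adicCompletion.baseChange K F (𝓞 F) v t w := by rw [ht, Pi.single_eq_same]
  rw [hy]
  clear hy ht
  induction t using TensorProduct.induction_on with
  | zero => simp
  | tmul f c =>
    rw [HeightOneSpectrum.adicCompletion.baseChange_tmul_apply, mul_comm, ← Algebra.smul_def]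
    exact Submodule.smul_mem _ c (Submodule.subset_span ⟨f, rfl⟩)
  | add a b ha hb => rw [map_add, Pi.add_apply]; exact Submodule.add_mem _ ha hb

/-- `τ ∈ Γ_{K_v}` fixes `algebraMap K_v K̄_v c`. [folklore] -/
theorem absoluteGaloisGroup_smul_algebraMap (τ : absoluteGaloisGroup (v.adicCompletion K)) (c : v.adicCompletion K) :
    τ • algebraMap (v.adicCompletion K) (AlgebraicClosure (v.adicCompletion K)) c =
      algebraMap (v.adicCompletion K) (AlgebraicClosure (v.adicCompletion K)) c := by
  rw [Field.absoluteGaloisGroup.smul_def]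
  exact AlgEquiv.commutes _ c

/-- **`τ ∈ Γ_{K_v}` fixes `e(F_w)` pointwise iff it fixes `e(F)` pointwise** (`e : F_w →ₐ[K_v] K̄_v`; `F_w = K_v·F` by
`span_range_algebraMap_adicCompletion_eq_top`, and `τ` is `K_v`-linear). [cite: CasselsFrohlichANT1967, Ch. II §10 Theorem (10.2)] -/
theorem forall_smul_algHom_apply_eq_iff [FiniteDimensional K F] (w : v.Extension (𝓞 F))
    (e : w.1.adicCompletion F →ₐ[v.adicCompletion K] AlgebraicClosure (v.adicCompletion K))
    (τ : absoluteGaloisGroup (v.adicCompletion K)) :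
    (∀ y : w.1.adicCompletion F, τ • e y = e y) ↔
      ∀ x : F, τ • e (algebraMap F (w.1.adicCompletion F) x) = e (algebraMap F (w.1.adicCompletion F) x) := by
  refine ⟨fun h x ↦ h _, fun h y ↦ ?_⟩
  have hy : y ∈ Submodule.span (v.adicCompletion K) (Set.range (algebraMap F (w.1.adicCompletion F))) := by
    rw [span_range_algebraMap_adicCompletion_eq_top v F w]; exact Submodule.mem_top
  induction hy using Submodule.span_induction with
  | mem y hy => obtain ⟨x, rfl⟩ := hy; exact h x
  | zero => rw [map_zero, smul_zero]
  | add a b _ _ ha hb => rw [map_add, smul_add, ha, hb]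
  | smul c a _ ha => rw [map_smul, Algebra.smul_def, smul_mul', ha, absoluteGaloisGroup_smul_algebraMap]

/-- **The pointwise fixer of `e(F_w)` in `Γ_{K_v}` is `θ_v⁻¹(σ·Gal(K̄/F)·σ⁻¹)`** when `e` extends `ι_v ∘ σ` on `F`:
`(∀ y, τ • e y = e y) ↔ σ⁻¹ · θ_v τ · σ ∈ Gal(K̄/F)`. [cite: NeukirchANT1999, Ch. II §9 Prop. (9.6)] -/
theorem forall_smul_algHom_apply_eq_iff_conj_absGaloisRestrict_mem [FiniteDimensional K F] (w : v.Extension (𝓞 F))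
    {σ : absoluteGaloisGroup K}
    {e : w.1.adicCompletion F →ₐ[v.adicCompletion K] AlgebraicClosure (v.adicCompletion K)}
    (he : ∀ x : F, e (algebraMap F (w.1.adicCompletion F) x) =
      absClosureEmbedding K (v.adicCompletion K) (σ • (x : AlgebraicClosure K)))
    (τ : absoluteGaloisGroup (v.adicCompletion K)) :
    (∀ y : w.1.adicCompletion F, τ • e y = e y) ↔
      σ⁻¹ * absGaloisRestrict K (v.adicCompletion K) τ * σ ∈ galFixing K F := by
  rw [forall_smul_algHom_apply_eq_iff v F w e τ, conj_absGaloisRestrict_mem_galFixing_iff]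
  refine ⟨fun h x hx ↦ ?_, fun h x ↦ ?_⟩
  · simpa only [he] using h ⟨x, hx⟩
  · simpa only [he] using h x x.2

/-! ## §6. `n`-th powers in `F_w` ⟷ fixed `n`-th roots / Kummer coboundaries on `θ_v⁻¹(σ·Gal(K̄/F)·σ⁻¹)` -/

/-- **`x` is an `n`-th power in `F_w` iff `ι_v(σ•x)` has an `n`-th root in `K̄_v` fixed by every `τ ∈ Γ_{K_v}` with
`σ⁻¹·θ_v τ·σ ∈ Gal(K̄/F)`**, for any `(σ, e)` cutting out `w` (`exists_algHom_adicCompletion_apply_eq_smul`).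
[cite: NeukirchANT1999, Ch. II §8 (8.1)–(8.3)] [cite: NeukirchANT1999, Ch. IV §1 (Krull's theorem (1.2))] -/
theorem exists_pow_eq_adicCompletion_iff_exists_fixed_pow_eq [FiniteDimensional K F] (w : v.Extension (𝓞 F))
    {σ : absoluteGaloisGroup K}
    {e : w.1.adicCompletion F →ₐ[v.adicCompletion K] AlgebraicClosure (v.adicCompletion K)}
    (he : ∀ x : F, e (algebraMap F (w.1.adicCompletion F) x) =
      absClosureEmbedding K (v.adicCompletion K) (σ • (x : AlgebraicClosure K)))
    (x : F) (n : ℕ) :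
    (∃ y : w.1.adicCompletion F, y ^ n = algebraMap F (w.1.adicCompletion F) x) ↔
      ∃ z : AlgebraicClosure (v.adicCompletion K),
        (∀ τ : absoluteGaloisGroup (v.adicCompletion K),
            σ⁻¹ * absGaloisRestrict K (v.adicCompletion K) τ * σ ∈ galFixing K F → τ • z = z) ∧
          z ^ n = absClosureEmbedding K (v.adicCompletion K) (σ • (x : AlgebraicClosure K)) := by
  haveI := LocalField.charZero_adicCompletion v
  rw [exists_pow_eq_iff_exists_forall_fixed_pow_eq_absoluteGaloisGroup e, he]
  simp only [forall_smul_algHom_apply_eq_iff_conj_absGaloisRestrict_mem v F w he]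

/-- **Coboundary form.** With `αⁿ = ι_v(σ•x)`, `x ≠ 0`: `x ∈ (F_w)ⁿ` iff `∃ ζ, ζⁿ = 1 ∧ τα·α⁻¹ = τζ·ζ⁻¹` for every `τ ∈ Γ_{K_v}` with
`σ⁻¹·θ_v τ·σ ∈ Gal(K̄/F)` — «the Kummer cocycle of `σ•x` is a `μₙ`-coboundary on `θ_v⁻¹(σ·Gal(K̄/F)·σ⁻¹)`».
[cite: SerreLocalFields1979, X §3 b)] [cite: NeukirchANT1999, Ch. II §8 (8.1)–(8.3)] -/
theorem exists_pow_eq_adicCompletion_iff_exists_pow_eq_one [FiniteDimensional K F] (w : v.Extension (𝓞 F))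
    {σ : absoluteGaloisGroup K}
    {e : w.1.adicCompletion F →ₐ[v.adicCompletion K] AlgebraicClosure (v.adicCompletion K)}
    (he : ∀ x : F, e (algebraMap F (w.1.adicCompletion F) x) =
      absClosureEmbedding K (v.adicCompletion K) (σ • (x : AlgebraicClosure K)))
    {x : F} (hx : x ≠ 0) {n : ℕ} {α : AlgebraicClosure (v.adicCompletion K)}
    (hα : α ^ n = absClosureEmbedding K (v.adicCompletion K) (σ • (x : AlgebraicClosure K))) :
    (∃ y : w.1.adicCompletion F, y ^ n = algebraMap F (w.1.adicCompletion F) x) ↔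
      ∃ ζ : AlgebraicClosure (v.adicCompletion K), ζ ^ n = 1 ∧
        ∀ τ : absoluteGaloisGroup (v.adicCompletion K),
          σ⁻¹ * absGaloisRestrict K (v.adicCompletion K) τ * σ ∈ galFixing K F → τ • α * α⁻¹ = τ • ζ * ζ⁻¹ := by
  rw [exists_pow_eq_adicCompletion_iff_exists_fixed_pow_eq v F w he x n]
  have hx' : absClosureEmbedding K (v.adicCompletion K) (σ • (x : AlgebraicClosure K)) ≠ 0 := by
    intro h0
    have h1 : σ • (x : AlgebraicClosure K) = 0 :=
      (map_eq_zero_iff _ (absClosureEmbedding K (v.adicCompletion K)).toRingHom.injective).1 h0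
    rw [smul_eq_zero_iff_eq_zero] at h1
    exact hx (by exact_mod_cast h1)
  exact exists_fixed_pow_eq_iff_exists_pow_eq_one (G := absoluteGaloisGroup (v.adicCompletion K))
    {τ | σ⁻¹ * absGaloisRestrict K (v.adicCompletion K) τ * σ ∈ galFixing K F} hα hx'

/-- **The consumer shape of the (PRO-NULL) road (R1's binder (ii) from the dual Selmer condition strict at `v`).** If for EVERY
`σ ∈ Γ_K` the element `ι_v(σ•x)` has an `n`-th root in `K̄_v` fixed by `θ_v⁻¹(σ·Gal(K̄/F)·σ⁻¹)`, then `x` is an `n`-th power in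
`F_w` for EVERY place `w ∣ v` of `F` (each `w` is cut out by some `ι_v ∘ σ`, §4).
[cite: NeukirchANT1999, Ch. II §8 (8.1)–(8.3)] -/
theorem forall_extension_exists_pow_eq_of_forall_exists_fixed [FiniteDimensional K F] (x : F) (n : ℕ)
    (h : ∀ σ : absoluteGaloisGroup K, ∃ z : AlgebraicClosure (v.adicCompletion K),
      (∀ τ : absoluteGaloisGroup (v.adicCompletion K),
          σ⁻¹ * absGaloisRestrict K (v.adicCompletion K) τ * σ ∈ galFixing K F → τ • z = z) ∧
        z ^ n = absClosureEmbedding K (v.adicCompletion K) (σ • (x : AlgebraicClosure K))) :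
    ∀ w : v.Extension (𝓞 F), ∃ y : w.1.adicCompletion F, y ^ n = algebraMap F (w.1.adicCompletion F) x := by
  intro w
  obtain ⟨σ, e, he⟩ := exists_algHom_adicCompletion_apply_eq_smul v F w
  exact (exists_pow_eq_adicCompletion_iff_exists_fixed_pow_eq v F w he x n).2 (h σ)

/-- **Coboundary version of the consumer shape.** If `x ≠ 0` and for EVERY `σ ∈ Γ_K` and SOME (equivalently every) `α` with
`αⁿ = ι_v(σ•x)` the Kummer cocycle `τ ↦ τα/α` is a `μₙ`-coboundary on `θ_v⁻¹(σ·Gal(K̄/F)·σ⁻¹)`, then `x ∈ (F_w)ⁿ` for every `w ∣ v`.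
[cite: SerreLocalFields1979, X §3 b)] [cite: NeukirchANT1999, Ch. II §8 (8.1)–(8.3)] -/
theorem forall_extension_exists_pow_eq_of_forall_exists_pow_eq_one [FiniteDimensional K F] {x : F} (hx : x ≠ 0) (n : ℕ)
    (h : ∀ σ : absoluteGaloisGroup K, ∃ α ζ : AlgebraicClosure (v.adicCompletion K),
      α ^ n = absClosureEmbedding K (v.adicCompletion K) (σ • (x : AlgebraicClosure K)) ∧ ζ ^ n = 1 ∧
        ∀ τ : absoluteGaloisGroup (v.adicCompletion K),
          σ⁻¹ * absGaloisRestrict K (v.adicCompletion K) τ * σ ∈ galFixing K F → τ • α * α⁻¹ = τ • ζ * ζ⁻¹) :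
    ∀ w : v.Extension (𝓞 F), ∃ y : w.1.adicCompletion F, y ^ n = algebraMap F (w.1.adicCompletion F) x := by
  intro w
  obtain ⟨σ, e, he⟩ := exists_algHom_adicCompletion_apply_eq_smul v F w
  obtain ⟨α, ζ, hα, hζ, hcob⟩ := h σ
  exact (exists_pow_eq_adicCompletion_iff_exists_pow_eq_one v F w he hx hα).2 ⟨ζ, hζ, hcob⟩

end AtV

end Summit.BirchSwinnertonDyer.BirchSwinnertonDyer.Theorems.PrintCf2.LocalPowersAtV
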